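import Summits.Ventures.PercRepro.RankDistTightSymm

/-!
# PercRepro — a symmetric log-concave sequence is smallest at its ends: the cumulative inequality for the
INDEPENDENT shadow follows from its ultra-log-concavity (p9, gen 19)

Arithmetic (`le_of_symm_logConcave`): a positive sequence `a_u` on `[q, n − q]` that is log-concave
(`a_u² ≥ a_{u−1}·a_{u+1}`) and symmetric (`a_u = a_{n−u}`) is non-decreasing up to the middle, so `a_q ≤ a_u` for every
`q ≤ u ≤ n − q` — the ratios `a_{u+1}/a_u` are non-increasing, and symmetry makes the ratio at `n − u − 1` the
inverse of the ratio at `u`, so the ratio is `≥ 1` below the middle.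
Matroids (`indepShadow_cumulative_of_ulc`): on the tight layer the independent shadow `i_u` (the bipartitions of `E`
into two independent sets, `RankDistTightSymm`) is symmetric (`card_indepShadow_symm`); if it is ultra-log-concave
with respect to `n = p + q` — `i_u²·C(n,u−1)·C(n,u+1) ≥ i_{u−1}·i_{u+1}·C(n,u)²`, the Lorentzian-type property
observed on every census cell, a HYPOTHESIS here — and non-zero on `[q, p]`, then
`i_q·C(n,u) ≤ i_u·C(n,q)` for every `q ≤ u ≤ p`: the cumulative shadow inequality holds for the independent part.
Nothing here is a statement about any window of the crux.
-/

namespace PercRepro.RankDist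

open Set Finset _root_.Matroid PercRepro.ThmH

/-- Log-concavity with positive entries: the ratio `a (u+1) / a u` is non-increasing — in product form,
`a (v+1) * a u ≤ a v * a (u+1)` for `u ≤ v` inside the range. -/
theorem ratio_antitone_of_logConcave (a : ℕ → ℚ) (lo hi : ℕ) (hpos : ∀ u, lo ≤ u → u ≤ hi → 0 < a u)
    (hlc : ∀ u, lo < u → u < hi → a (u - 1) * a (u + 1) ≤ a u * a u) :
    ∀ u v, lo ≤ u → u ≤ v → v + 1 ≤ hi → a (v + 1) * a u ≤ a v * a (u + 1) := by
  intro u v hlou huv hvhi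
  induction v, huv using Nat.le_induction with
  | base => exact le_of_eq (mul_comm _ _)
  | succ v huv ih =>
    have ih' := ih (by omega)
    -- `a (v+2) * a v ≤ a (v+1) * a (v+1)` (log-concavity at `v + 1`)
    have h1 := hlc (v + 1) (by omega) (by omega)
    rw [show v + 1 - 1 = v by omega] at h1
    have hv : 0 < a v := hpos v (by omega) (by omega)
    have hv1 : 0 < a (v + 1) := hpos (v + 1) (by omega) (by omega)
    have hu : 0 < a u := hpos u hlou (by omega)
    -- multiply `a (v+2) * a v ≤ a (v+1)^2` by `a u` and use `ih'`: `a (v+1) * a u ≤ a v * a (u+1)`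
    have h2 : a (v + 1 + 1) * a u * a v ≤ a (v + 1) * (a (v + 1) * a u) := by
      calc a (v + 1 + 1) * a u * a v = (a v * a (v + 1 + 1)) * a u := by ring
        _ ≤ (a (v + 1) * a (v + 1)) * a u := mul_le_mul_of_nonneg_right h1 hu.le
        _ = a (v + 1) * (a (v + 1) * a u) := by ring
    have h3 : a (v + 1) * (a (v + 1) * a u) ≤ a (v + 1) * (a v * a (u + 1)) :=
      mul_le_mul_of_nonneg_left ih' hv1.le
    have h4 : a (v + 1 + 1) * a u * a v ≤ (a (v + 1) * a (u + 1)) * a v := by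
      calc a (v + 1 + 1) * a u * a v ≤ a (v + 1) * (a v * a (u + 1)) := h2.trans h3
        _ = (a (v + 1) * a (u + 1)) * a v := by ring
    exact le_of_mul_le_mul_right h4 hv

/-- **A positive, log-concave, symmetric sequence is smallest at the ends**: `a q ≤ a u` for `q ≤ u ≤ n − q`. -/
theorem le_of_symm_logConcave (a : ℕ → ℚ) (n q : ℕ) (hqn : 2 * q ≤ n)
    (hpos : ∀ u, q ≤ u → u ≤ n - q → 0 < a u)
    (hsym : ∀ u, u ≤ n → a u = a (n - u))
    (hlc : ∀ u, q < u → u < n - q → a (u - 1) * a (u + 1) ≤ a u * a u) :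
    ∀ u, q ≤ u → u ≤ n - q → a q ≤ a u := by
  -- step: below the middle the sequence is non-decreasing
  have hstep : ∀ u, q ≤ u → 2 * u + 1 ≤ n → a u ≤ a (u + 1) := by
    intro u hqu hu
    have hv : u ≤ n - u - 1 := by omega
    have h := ratio_antitone_of_logConcave a q (n - q) hpos hlc u (n - u - 1) hqu hv (by omega)
    -- `a (n - u) * a u ≤ a (n - u - 1) * a (u + 1)`; by symmetry `a (n - u) = a u`, `a (n - u - 1) = a (u + 1)`
    rw [show n - u - 1 + 1 = n - u by omega, ← hsym u (by omega),
      show n - u - 1 = n - (u + 1) by omega, ← hsym (u + 1) (by omega)] at h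
    have hu0 : 0 < a u := hpos u hqu (by omega)
    have hu1 : 0 < a (u + 1) := hpos (u + 1) (by omega) (by omega)
    -- `a u * a u ≤ a (u+1) * a (u+1)` with both positive gives `a u ≤ a (u+1)`
    by_contra hcon
    push Not at hcon
    have : a (u + 1) * a (u + 1) < a u * a u := by nlinarith
    linarith
  -- chain up to the middle
  have hchain : ∀ u, q ≤ u → 2 * u ≤ n → a q ≤ a u := by
    intro u hqu hu
    induction u, hqu using Nat.le_induction with
    | base => exact le_refl _
    | succ v hqv ih => exact (ih (by omega)).trans (hstep v hqv (by omega))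
  intro u hqu hun
  by_cases hmid : 2 * u ≤ n
  · exact hchain u hqu hmid
  · rw [hsym u (by omega)]
    exact hchain (n - u) (by omega) (by omega)

variable {α : Type} [DecidableEq α] (M : Matroid α) [M.Finite]

/-- **The cumulative inequality for the independent shadow follows from its ultra-log-concavity** (tight layer):
if `i_u ≠ 0` on `[q, p]` and `i_u²·C(n,u−1)·C(n,u+1) ≥ i_{u−1}·i_{u+1}·C(n,u)²` for `q < u < p` (`n = p + q`), then
`i_q·C(n,u) ≤ i_u·C(n,q)` for every `q ≤ u ≤ p`. -/
theorem indepShadow_cumulative_of_ulc {p q : ℕ} (hn : (gr M).card = p + q) (hr : M.eRank = (p : ℕ∞))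
    (hqp : q ≤ p)
    (hpos : ∀ u, q ≤ u → u ≤ p → (indepShadow M p q u).card ≠ 0)
    (hulc : ∀ u, q < u → u < p →
      (indepShadow M p q (u - 1)).card * (indepShadow M p q (u + 1)).card * ((p + q).choose u) ^ 2
        ≤ (indepShadow M p q u).card * (indepShadow M p q u).card
          * ((p + q).choose (u - 1) * (p + q).choose (u + 1))) :
    ∀ u, q ≤ u → u ≤ p →
      (indepShadow M p q q).card * (p + q).choose u ≤ (indepShadow M p q u).card * (p + q).choose q := by
  set a : ℕ → ℚ := fun u => ((indepShadow M p q u).card : ℚ) / ((p + q).choose u : ℚ) with ha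
  have hchoose : ∀ u, u ≤ p + q → (0 : ℚ) < ((p + q).choose u : ℚ) := fun u hu => by
    exact_mod_cast Nat.choose_pos hu
  have key := le_of_symm_logConcave a (p + q) q (by omega)
    (by
      intro u hqu hup
      have h1 : (0 : ℚ) < ((indepShadow M p q u).card : ℚ) := by
        exact_mod_cast Nat.pos_of_ne_zero (hpos u hqu (by omega))
      exact div_pos h1 (hchoose u (by omega)))
    (by
      intro u hu
      simp only [ha]
      rw [card_indepShadow_symm M hn hr hu, Nat.choose_symm hu])
    (by
      intro u hqu hup
      simp only [ha]
      have h := hulc u hqu (by omega)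
      have c0 := hchoose u (by omega)
      have c1 := hchoose (u - 1) (by omega)
      have c2 := hchoose (u + 1) (by omega)
      rw [div_mul_div_comm, div_mul_div_comm, div_le_div_iff₀ (by positivity) (by positivity)]
      have h' : ((indepShadow M p q (u - 1)).card : ℚ) * (indepShadow M p q (u + 1)).card
          * ((p + q).choose u : ℚ) ^ 2
          ≤ ((indepShadow M p q u).card : ℚ) * (indepShadow M p q u).card
            * (((p + q).choose (u - 1) : ℚ) * ((p + q).choose (u + 1) : ℚ)) := by
        exact_mod_cast h
      nlinarith [h'])
  intro u hqu hup
  have h := key u hqu (by omega)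
  simp only [ha] at h
  rw [div_le_div_iff₀ (hchoose q (by omega)) (hchoose u (by omega))] at h
  exact_mod_cast h

end PercRepro.RankDist
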